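import Mathlib.NumberTheory.LSeries.DirichletContinuation
import Mathlib.NumberTheory.LSeries.PrimesInAP
import Mathlib.NumberTheory.EulerProduct.DirichletLSeries
import Mathlib.NumberTheory.EulerProduct.ExpLog
import Mathlib.Analysis.SpecialFunctions.Complex.LogBounds
import Mathlib.Data.Nat.Factorization.Induction
import Literature.NumberTheory.LFunctions.SaiasWeingartner
import HarnessLib

/-!
# Unimodular twists of Dirichlet `L`-series and of their linear combinations

Topic `Literature/NumberTheory/LFunctions` (namespace `Literature.NumberTheory.LFunctions`).
Everything in this file is PROVED; there are no definitions and no named facts. It is the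
bookkeeping part of the proof of the right half of Saias–Weingartner 2009, Theorem 2
(`Literature.NumberTheory.LFunctions.SaiasWeingartner2009_thm2_right`, proved in
`SaiasWeingartnerProofs.lean`), §4 of the paper: the functions
`G_j(s) = h_j(p_1^{-s-it_{p_1}}, …) ∏_{p} (1 - χ_j(p) p^{-s-it_p})⁻¹` obtained from
`F_j(s) = P_j(s) L(s, χ_j)` by giving every prime an independent phase.

A *twist* is a completely multiplicative `u : ℕ →*₀ ℂ` with `|u(p)| = 1` on the primes; the
vertical shift `s ↦ s + it` is the twist `u(n) = n^{-it}` (`exists_shift_twist`), and every choice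
of prime phases is realised by a twist (`exists_twist`).

* `SWTwist.exists_twist`, `SWTwist.norm_twist`, `SWTwist.exists_shift_twist`;
* `SWTwist.LSeries_add_eq_twist` — `L(f, s + it) = L(f · n^{-it}, s)`;
* `SWTwist.exp_tsum_log_eq_LSeries_twist` — the Euler product of the twisted `L`-series
  `exp (∑_p -log(1 - χ(p) u(p) p^{-s})) = L(χ u, s)` (`Re s > 1`);
* `SWTwist.convolution_twist`, `SWTwist.sum_LSeries_mul_eq` — twisting commutes with Dirichlet
  convolution, so `∑_j L(P_j u, s) L(χ_j u, s) = L(a u, s)` with `a = ∑_j P_j ⋆ χ_j` the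
  coefficient sequence of `F`;
* `SWTwist.sigma_eq_of_changeLevel_eq` — distinct primitive characters induce distinct
  characters modulo a common multiple; `SWTwist.sum_units_mul_inv` — row orthogonality;
* `SWTwist.exists_coeff_ne_zero` — **the coefficients of `F` are not all zero** for an
  `IsSWFamily` (Dirichlet's theorem on primes in progressions and the independence of the
  induced characters).

## References

* [SaiasWeingartner2009] E. Saias, A. Weingartner, Acta Arith. 140 (2009), 335–344, §4.
-/

noncomputable section

open Complex Filter Finset LSeries DirichletCharacter
open scoped LSeries.notation

namespace Literature.NumberTheory.LFunctions

namespace SWTwist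

/-! ### Twists -/

/-- **Every choice of prime phases is a twist**: for `θ : ℕ → ℝ` there is a completely
multiplicative `u : ℕ →*₀ ℂ` with `u(p) = e^{iθ_p}` for every prime `p`. [folklore] -/
theorem exists_twist (θ : ℕ → ℝ) : ∃ u : ℕ →*₀ ℂ, ∀ p : ℕ, p.Prime → u p = cexp (θ p * I) := by
  classical
  let g : ℕ → ℕ → ℂ := fun p e ↦ cexp (θ p * I) ^ e
  have hg0 : ∀ p, g p 0 = 1 := fun p ↦ pow_zero _
  have hgadd : ∀ p a b, g p (a + b) = g p a * g p b := fun p a b ↦ pow_add _ _ _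
  let v : ℕ → ℂ := fun n ↦ if n = 0 then 0 else n.factorization.prod g
  have hv0 : v 0 = 0 := if_pos rfl
  have hvne : ∀ n, n ≠ 0 → v n = n.factorization.prod g := fun n hn ↦ if_neg hn
  have hv1 : v 1 = 1 := by rw [hvne 1 one_ne_zero, Nat.factorization_one, Finsupp.prod_zero_index]
  have hvmul : ∀ m n, v (m * n) = v m * v n := by
    intro m n
    rcases eq_or_ne m 0 with rfl | hm
    · simp [hv0]
    rcases eq_or_ne n 0 with rfl | hn
    · simp [hv0]
    rw [hvne _ (mul_ne_zero hm hn), hvne m hm, hvne n hn, Nat.factorization_mul hm hn,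
      Finsupp.prod_add_index' hg0 hgadd]
  refine ⟨⟨⟨v, hv0⟩, hv1, hvmul⟩, fun p hp ↦ ?_⟩
  show v p = _
  rw [hvne p hp.ne_zero, hp.factorization, Finsupp.prod_single_index (hg0 p)]
  exact pow_one _

/-- A twist is unimodular on the positive integers. [folklore] -/
theorem norm_twist {u : ℕ →*₀ ℂ} (hu : ∀ p : ℕ, p.Prime → ‖u p‖ = 1) {n : ℕ} (hn : n ≠ 0) :
    ‖u n‖ = 1 := by
  induction n using induction_on_primes with
  | zero => exact (hn rfl).elim
  | one => rw [map_one, norm_one]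
  | prime_mul p a hp ih =>
    rw [map_mul, norm_mul, hu p hp, one_mul]
    exact ih (right_ne_zero_of_mul hn)

/-- A twist has norm at most one everywhere. [folklore] -/
theorem norm_twist_le {u : ℕ →*₀ ℂ} (hu : ∀ p : ℕ, p.Prime → ‖u p‖ = 1) (n : ℕ) : ‖u n‖ ≤ 1 := by
  rcases eq_or_ne n 0 with rfl | hn
  · rw [map_zero, norm_zero]; exact zero_le_one
  · exact (norm_twist hu hn).le

/-- **The vertical shift is a twist**: for real `t` there is a twist `u` with `u(n) = n^{-it}`
for all `n ≥ 1`; on primes `u(p) = e^{i(-t log p)}`. [folklore] -/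
theorem exists_shift_twist (t : ℝ) : ∃ u : ℕ →*₀ ℂ,
    (∀ p : ℕ, p.Prime → u p = cexp (((-(t * Real.log p) : ℝ) : ℂ) * I)) ∧
    (∀ p : ℕ, p.Prime → ‖u p‖ = 1) ∧
    ∀ n : ℕ, n ≠ 0 → u n = (n : ℂ) ^ (-(t * I)) := by
  obtain ⟨u, hu⟩ := exists_twist fun p ↦ -(t * Real.log p)
  have hcpow : ∀ n : ℕ, n ≠ 0 → (n : ℂ) ^ (-(t * I)) = cexp (((-(t * Real.log n) : ℝ) : ℂ) * I) := by
    intro n hn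
    rw [cpow_def_of_ne_zero (Nat.cast_ne_zero.2 hn)]
    congr 1
    push_cast
    ring
  refine ⟨u, hu, fun p hp ↦ by rw [hu p hp]; exact norm_exp_ofReal_mul_I _, fun n hn ↦ ?_⟩
  induction n using induction_on_primes with
  | zero => exact (hn rfl).elim
  | one => rw [map_one, Nat.cast_one, one_cpow]
  | prime_mul p a hp ih =>
    have ha : a ≠ 0 := right_ne_zero_of_mul hn
    rw [map_mul, ih ha, hu p hp, ← hcpow p hp.ne_zero, Nat.cast_mul, natCast_mul_natCast_cpow]

/-- **Shifting an `L`-series is twisting its coefficients**: `L(f, s + w) = L(f · n^{-w}, s)`.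
[folklore] -/
theorem LSeries_add_eq (f : ℕ → ℂ) (s w : ℂ) :
    LSeries f (s + w) = LSeries (fun n ↦ f n * (n : ℂ) ^ (-w)) s := by
  refine tsum_congr fun n ↦ ?_
  rcases eq_or_ne n 0 with rfl | hn
  · simp [term_zero]
  rw [term_of_ne_zero hn, term_of_ne_zero hn, cpow_add _ _ (Nat.cast_ne_zero.2 hn), cpow_neg]
  field_simp

/-- `L(f, s + it) = L(f u, s)` for the shift twist `u(n) = n^{-it}`. [folklore] -/
theorem LSeries_add_eq_twist (f : ℕ → ℂ) (s : ℂ) (t : ℝ) {u : ℕ →*₀ ℂ}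
    (hu : ∀ n : ℕ, n ≠ 0 → u n = (n : ℂ) ^ (-(t * I))) :
    LSeries f (s + t * I) = LSeries (fun n ↦ f n * u n) s := by
  rw [LSeries_add_eq]
  refine LSeries_congr (fun {n} hn ↦ ?_) s
  rw [hu n hn]

/-! ### Twisted Dirichlet `L`-series and their Euler products -/

/-- The twisted summand `n ↦ χ(n) u(n) n^{-s}` as a completely multiplicative function.
[folklore] -/
theorem exists_hom_eq {N : ℕ} (χ : DirichletCharacter ℂ N) (u : ℕ →*₀ ℂ) {s : ℂ} (hs : s ≠ 0) :
    ∃ f : ℕ →*₀ ℂ, ∀ n : ℕ, f n = χ n * u n * (n : ℂ) ^ (-s) := by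
  refine ⟨dirichletSummandHom χ hs * u, fun n ↦ ?_⟩
  show (dirichletSummandHom χ hs) n * u n = _
  simp only [dirichletSummandHom, MonoidWithZeroHom.coe_mk, ZeroHom.coe_mk]
  ring

/-- Norm of the twisted summand: `‖χ(n) u(n) n^{-s}‖ ≤ n^{-Re s}`. [folklore] -/
theorem norm_summand_le {N : ℕ} (χ : DirichletCharacter ℂ N) {u : ℕ →*₀ ℂ}
    (hu : ∀ p : ℕ, p.Prime → ‖u p‖ = 1) (s : ℂ) (n : ℕ) :
    ‖χ n * u n * (n : ℂ) ^ (-s)‖ ≤ (n : ℝ) ^ (-s.re) := by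
  rcases eq_or_ne n 0 with rfl | hn
  · simp only [Nat.cast_zero, map_zero, mul_zero, zero_mul, norm_zero]
    exact Real.rpow_nonneg le_rfl _
  rw [norm_mul, norm_mul, norm_natCast_cpow_of_pos (Nat.pos_of_ne_zero hn), neg_re]
  have h1 := χ.norm_le_one n
  have h2 := norm_twist_le hu n
  have h3 : 0 ≤ (n : ℝ) ^ (-s.re) := Real.rpow_nonneg (Nat.cast_nonneg _) _
  calc ‖χ n‖ * ‖u n‖ * (n : ℝ) ^ (-s.re) ≤ 1 * 1 * (n : ℝ) ^ (-s.re) := by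
        gcongr
    _ = (n : ℝ) ^ (-s.re) := by ring

/-- The twisted summands are absolutely summable for `Re s > 1`. [folklore] -/
theorem summable_norm_summand {N : ℕ} (χ : DirichletCharacter ℂ N) {u : ℕ →*₀ ℂ}
    (hu : ∀ p : ℕ, p.Prime → ‖u p‖ = 1) {s : ℂ} (hs : 1 < s.re) :
    Summable fun n : ℕ ↦ ‖χ n * u n * (n : ℂ) ^ (-s)‖ :=
  (Real.summable_nat_rpow.2 (by linarith : -s.re < -1)).of_nonneg_of_le (fun _ ↦ norm_nonneg _)
    (norm_summand_le χ hu s)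

/-- The twisted coefficients `χ u` have summable `L`-series for `Re s > 1`. [folklore] -/
theorem LSeriesSummable_twist {N : ℕ} (χ : DirichletCharacter ℂ N) {u : ℕ →*₀ ℂ}
    (hu : ∀ p : ℕ, p.Prime → ‖u p‖ = 1) {s : ℂ} (hs : 1 < s.re) :
    LSeriesSummable (fun n ↦ χ n * u n) s := by
  refine LSeriesSummable_of_le_const_mul_rpow hs ⟨1, fun n _ ↦ ?_⟩
  rw [sub_self, Real.rpow_zero, mul_one, norm_mul]
  exact mul_le_one₀ (χ.norm_le_one n) (norm_nonneg _) (norm_twist_le hu n)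

/-- **Euler product of a twisted Dirichlet `L`-series**:
`exp (∑_p -log (1 - χ(p) u(p) p^{-s})) = L(χ u, s)` for `Re s > 1`. [folklore] -/
theorem exp_tsum_log_eq_LSeries_twist {N : ℕ} (χ : DirichletCharacter ℂ N) {u : ℕ →*₀ ℂ}
    (hu : ∀ p : ℕ, p.Prime → ‖u p‖ = 1) {s : ℂ} (hs : 1 < s.re) :
    cexp (∑' p : Nat.Primes, -log (1 - χ p * u p * (p : ℂ) ^ (-s))) =
      LSeries (fun n ↦ χ n * u n) s := by
  obtain ⟨f, hf⟩ := exists_hom_eq χ u (ne_zero_of_one_lt_re hs)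
  have hsum : Summable fun n ↦ ‖f n‖ := by
    simpa only [hf] using summable_norm_summand χ hu hs
  have h := EulerProduct.exp_tsum_primes_log_eq_tsum hsum
  simp only [hf] at h
  rw [h]
  refine tsum_congr fun n ↦ ?_
  rcases eq_or_ne n 0 with rfl | hn
  · simp [term_zero]
  rw [term_of_ne_zero hn, cpow_neg, div_eq_mul_inv]


/-! ### Twisting commutes with Dirichlet convolution -/

/-- `(f u) ⋆ (g u) = (f ⋆ g) u` for a completely multiplicative `u`. [folklore] -/
theorem convolution_twist (f g : ℕ → ℂ) (u : ℕ →*₀ ℂ) :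
    (fun n ↦ f n * u n) ⍟ (fun n ↦ g n * u n) = fun n ↦ (f ⍟ g) n * u n := by
  ext n
  rw [convolution_def, convolution_def]
  simp only
  rw [Finset.sum_mul]
  refine sum_congr rfl fun p hp ↦ ?_
  have h := (Nat.mem_divisorsAntidiagonal.1 hp).1
  rw [← h, map_mul]
  ring

/-- A finitely supported sequence, twisted, has an everywhere convergent `L`-series. [folklore] -/
theorem LSeriesSummable_of_finite {f : ℕ → ℂ} (hf : (Function.support f).Finite) (v : ℕ → ℂ)
    (s : ℂ) : LSeriesSummable (fun n ↦ f n * v n) s := by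
  refine summable_of_hasFiniteSupport (hf.subset fun n hn ↦ ?_)
  rw [Function.mem_support] at hn ⊢
  intro h
  apply hn
  rcases eq_or_ne n 0 with rfl | hn0
  · exact term_zero _ _
  · rw [term_of_ne_zero hn0, h, zero_mul, zero_div]

/-- **The twisted combination is one `L`-series**: for twists `u` and `Re s > 1`,
`∑_j L(P_j u, s) · L(χ_j u, s) = L(a u, s)` with `a = ∑_j P_j ⋆ χ_j` the Dirichlet
coefficients of `F = ∑_j P_j L(·, χ_j)`. [cite: SaiasWeingartner2009, §4 (definition of G_j)] -/
theorem sum_LSeries_mul_eq {ι : Type*} [Fintype ι] {q : ι → ℕ} (χ : ∀ i, DirichletCharacter ℂ (q i))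
    {P : ι → ℕ → ℂ} (hP : ∀ i, (Function.support (P i)).Finite) {u : ℕ →*₀ ℂ}
    (hu : ∀ p : ℕ, p.Prime → ‖u p‖ = 1) {s : ℂ} (hs : 1 < s.re) :
    ∑ i, LSeries (fun n ↦ P i n * u n) s * LSeries (fun n ↦ χ i n * u n) s =
      LSeries (fun n ↦ (∑ i, ((P i) ⍟ (fun m ↦ χ i m)) n) * u n) s := by
  classical
  have hterm : ∀ i, LSeries (fun n ↦ P i n * u n) s * LSeries (fun n ↦ χ i n * u n) s =
      LSeries (fun n ↦ ((P i) ⍟ (fun m ↦ χ i m)) n * u n) s := by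
    intro i
    rw [← LSeries_convolution' (LSeriesSummable_of_finite (hP i) u s)
      (LSeriesSummable_twist (χ i) hu hs), convolution_twist]
  have hsum : ∀ i ∈ (univ : Finset ι),
      LSeriesSummable (fun n ↦ ((P i) ⍟ (fun m ↦ χ i m)) n * u n) s := by
    intro i _
    rw [← convolution_twist]
    exact (LSeriesSummable_of_finite (hP i) u s).convolution (LSeriesSummable_twist (χ i) hu hs)
  simp_rw [hterm]
  rw [← LSeries_sum hsum]
  congr 1
  ext n
  simp [Finset.sum_apply, Finset.sum_mul]

/-! ### Distinct primitive characters stay distinct modulo a common multiple -/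

/-- If two PRIMITIVE Dirichlet characters induce the same character modulo a common multiple
of their levels, they are equal (as pairs level/character): the conductor is invariant under
`changeLevel`. [folklore] -/
theorem sigma_eq_of_changeLevel_eq {Q : ℕ} [NeZero Q] {n m : ℕ} (ψ : DirichletCharacter ℂ n)
    (φ : DirichletCharacter ℂ m) (hn : n ∣ Q) (hm : m ∣ Q) (hψ : ψ.IsPrimitive)
    (hφ : φ.IsPrimitive) (h : changeLevel hn ψ = changeLevel hm φ) :
    (⟨n, ψ⟩ : Σ k, DirichletCharacter ℂ k) = ⟨m, φ⟩ := by
  have h1 : (changeLevel hn ψ).conductor = n := (conductor_changeLevel ψ hn).trans hψ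
  have h2 : (changeLevel hm φ).conductor = m := (conductor_changeLevel φ hm).trans hφ
  have hnm : n = m := by rw [← h1, ← h2, h]
  subst hnm
  rw [changeLevel_injective hn h]

/-! ### Row orthogonality -/

/-- A sum over the units of `ZMod Q` of a function vanishing off the units is the sum over
`ZMod Q`. [folklore] -/
theorem sum_units_eq_sum {Q : ℕ} [NeZero Q] (f : ZMod Q → ℂ) (hf : ∀ a, ¬IsUnit a → f a = 0) :
    ∑ x : (ZMod Q)ˣ, f x = ∑ a : ZMod Q, f a := by
  classical
  have h : ∑ x : (ZMod Q)ˣ, f x =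
      ∑ a ∈ univ.map ⟨((↑) : (ZMod Q)ˣ → ZMod Q), Units.val_injective⟩, f a := by
    rw [Finset.sum_map]
    rfl
  rw [h]
  refine Finset.sum_subset (subset_univ _) fun a _ ha ↦ hf a fun hu ↦ ha ?_
  rw [Finset.mem_map]
  exact ⟨hu.unit, mem_univ _, hu.unit_spec⟩

/-- **Row orthogonality of Dirichlet characters**: for characters `χ, ψ` mod `Q`,
`∑_{x ∈ (ℤ/Q)ˣ} χ(x) ψ(x)⁻¹ = φ(Q)` if `χ = ψ` and `0` otherwise. [folklore] -/
theorem sum_units_mul_inv {Q : ℕ} [NeZero Q] [DecidableEq (DirichletCharacter ℂ Q)]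
    (χ ψ : DirichletCharacter ℂ Q) :
    ∑ x : (ZMod Q)ˣ, χ x * (ψ x)⁻¹ = if χ = ψ then (Q.totient : ℂ) else 0 := by
  classical
  split_ifs with h
  · subst h
    have : ∀ x : (ZMod Q)ˣ, χ x * (χ x)⁻¹ = 1 := by
      intro x
      rw [← MulChar.coe_toUnitHom]
      exact mul_inv_cancel₀ (Units.ne_zero _)
    simp only [this, sum_const, card_univ, ZMod.card_units_eq_totient, nsmul_eq_mul, mul_one]
  · have hne : χ * ψ⁻¹ ≠ 1 := fun h' ↦ h (mul_inv_eq_one.1 h')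
    have h0 := MulChar.sum_eq_zero_of_ne_one hne
    rw [← h0, ← sum_units_eq_sum]
    · refine sum_congr rfl fun x _ ↦ ?_
      rw [MulChar.coeToFun_mul, Pi.mul_apply, MulChar.inv_apply_eq_inv']
    · intro a ha
      rw [MulChar.map_nonunit _ ha]

/-! ### The coefficients of `F` are not all zero -/

/-- For a prime `p` exceeding the support bound `K` of the `P_j`, the coefficient of
`F = ∑_j P_j L(·, χ_j)` at `k₀ p`, where `k₀ ≥ 1` is the least index carrying a non-zero
coefficient of some `P_j`, is `∑_j P_j(k₀) χ_j(p)`. [cite: SaiasWeingartner2009, §4] -/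
theorem coeff_mul_prime_eq {ι : Type*} [Fintype ι] {q : ι → ℕ} (χ : ∀ i, DirichletCharacter ℂ (q i))
    (P : ι → ℕ → ℂ) {K k₀ p : ℕ} (hK : ∀ i n, P i n ≠ 0 → n ≤ K) (hk₀ : k₀ ≠ 0)
    (hmin : ∀ k, k ≠ 0 → (∃ i, P i k ≠ 0) → k₀ ≤ k) (hp : p.Prime) (hKp : K < p) :
    ∑ i, ((P i) ⍟ (fun m ↦ χ i m)) (k₀ * p) = ∑ i, P i k₀ * χ i p := by
  refine sum_congr rfl fun i _ ↦ ?_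
  rw [convolution_def]
  simp only
  have hmem : (k₀, p) ∈ (k₀ * p).divisorsAntidiagonal :=
    Nat.mem_divisorsAntidiagonal.2 ⟨rfl, mul_ne_zero hk₀ hp.ne_zero⟩
  rw [Finset.sum_eq_single_of_mem (k₀, p) hmem]
  rintro ⟨d₁, d₂⟩ hd hne
  simp only
  by_cases hP : P i d₁ = 0
  · rw [hP, zero_mul]
  exfalso
  obtain ⟨hd12, -⟩ := Nat.mem_divisorsAntidiagonal.1 hd
  simp only at hd12
  have hd₁0 : d₁ ≠ 0 := left_ne_zero_of_mul (hd12.symm ▸ mul_ne_zero hk₀ hp.ne_zero)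
  have hd₁K : d₁ ≤ K := hK i d₁ hP
  have hndvd : ¬p ∣ d₁ := fun h ↦ absurd (Nat.le_of_dvd (Nat.pos_of_ne_zero hd₁0) h) (by omega)
  have hcop : Nat.Coprime d₁ p := Nat.Coprime.symm ((Nat.Prime.coprime_iff_not_dvd hp).2 hndvd)
  have hdvd : d₁ ∣ k₀ := hcop.dvd_of_dvd_mul_right (Dvd.intro d₂ hd12)
  have hle : k₀ ≤ d₁ := hmin d₁ hd₁0 ⟨i, hP⟩
  have heq : d₁ = k₀ := le_antisymm (Nat.le_of_dvd (Nat.pos_of_ne_zero hk₀) hdvd) hle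
  subst heq
  have hd₂ : d₂ = p := Nat.eq_of_mul_eq_mul_left (Nat.pos_of_ne_zero hk₀) hd12
  subst hd₂
  exact hne rfl

/-- **The coefficients of `F` are not all zero.** For an `IsSWFamily` (`≥ 2` pairwise distinct
primitive characters, non-zero Dirichlet polynomials `P_j`), the Dirichlet coefficients
`a = ∑_j P_j ⋆ χ_j` of `F = ∑_j P_j L(·, χ_j)` do not all vanish: with `k₀` the least index
carrying a non-zero coefficient, `a(k₀ p) = ∑_j P_j(k₀) χ_j(p)` for all large primes `p`; if
these all vanished, Dirichlet's theorem on primes in progressions and the orthogonality of the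
(distinct) induced characters modulo `∏ q_j` would force `P_j(k₀) = 0` for every `j`.
[cite: SaiasWeingartner2009, §4] -/
theorem exists_coeff_ne_zero {ι : Type} [Fintype ι] {q : ι → ℕ} [∀ i, NeZero (q i)]
    {χ : ∀ i, DirichletCharacter ℂ (q i)} {P : ι → ℕ → ℂ} (hF : IsSWFamily χ P) :
    ∃ N : ℕ, ∑ i, ((P i) ⍟ (fun m ↦ χ i m)) N ≠ 0 := by
  classical
  -- common modulus and induced characters
  set Q : ℕ := ∏ i, q i with hQ
  have hQ0 : Q ≠ 0 := Finset.prod_ne_zero_iff.2 fun i _ ↦ (NeZero.ne (q i))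
  haveI : NeZero Q := ⟨hQ0⟩
  have hdvd : ∀ i, q i ∣ Q := fun i ↦ Finset.dvd_prod_of_mem q (mem_univ i)
  set χ' : ∀ i, DirichletCharacter ℂ Q := fun i ↦ changeLevel (hdvd i) (χ i) with hχ'
  have hinj : Function.Injective χ' := by
    intro i j hij
    have := sigma_eq_of_changeLevel_eq (χ i) (χ j) (hdvd i) (hdvd j) (hF.isPrimitive i)
      (hF.isPrimitive j) hij
    exact hF.injective this
  -- support bound and least index
  have hK : ∃ K : ℕ, ∀ i n, P i n ≠ 0 → n ≤ K := by
    choose K hK using fun i ↦ (hF.finite_support i).bddAbove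
    refine ⟨univ.sup K, fun i n hn ↦ ?_⟩
    exact (hK i (Function.mem_support.2 hn)).trans (Finset.le_sup (mem_univ i))
  obtain ⟨K, hK⟩ := hK
  have hex : ∃ k, k ≠ 0 ∧ ∃ i, P i k ≠ 0 := by
    obtain ⟨i⟩ := hF.nonempty
    obtain ⟨n, hn, hPn⟩ := hF.exists_ne_zero i
    exact ⟨n, hn, i, hPn⟩
  set k₀ := Nat.find hex with hk₀def
  obtain ⟨hk₀, i₀, hi₀⟩ := Nat.find_spec hex
  have hmin : ∀ k, k ≠ 0 → (∃ i, P i k ≠ 0) → k₀ ≤ k :=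
    fun k hk h ↦ Nat.find_min' hex ⟨hk, h⟩
  -- suppose all coefficients vanish
  by_contra hall
  push Not at hall
  -- then `∑_j P_j(k₀) χ'_j(x) = 0` for every unit `x`
  have hvan : ∀ x : (ZMod Q)ˣ, ∑ i, P i k₀ * χ' i x = 0 := by
    intro x
    obtain ⟨p, hpgt, hp, hpx⟩ := Nat.forall_exists_prime_gt_and_eq_mod (Units.isUnit x) (max K Q)
    have hKp : K < p := lt_of_le_of_lt (le_max_left _ _) hpgt
    have hQp : Q < p := lt_of_le_of_lt (le_max_right _ _) hpgt
    have hcoeff := coeff_mul_prime_eq χ P hK hk₀ hmin hp hKp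
    rw [hall (k₀ * p)] at hcoeff
    rw [hcoeff]
    refine sum_congr rfl fun i _ ↦ ?_
    congr 1
    -- `χ' i x = χ i p`
    have hcop : IsCoprime (p : ℤ) Q := by
      rw [Nat.isCoprime_iff_coprime]
      exact (Nat.Prime.coprime_iff_not_dvd hp).2
        fun h ↦ absurd (Nat.le_of_dvd (Nat.pos_of_ne_zero hQ0) h) (by omega)
    have h1 := changeLevel_eq_cast_of_dvd' (χ i) (hdvd i) hcop
    rw [Int.cast_natCast, Int.cast_natCast] at h1
    rw [← hpx]
    exact h1
  -- orthogonality against `χ' i₀`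
  have hsum : ∑ x : (ZMod Q)ˣ, (∑ i, P i k₀ * χ' i x) * (χ' i₀ x)⁻¹ = 0 :=
    sum_eq_zero fun x _ ↦ by rw [hvan x, zero_mul]
  have hsum' : ∑ x : (ZMod Q)ˣ, (∑ i, P i k₀ * χ' i x) * (χ' i₀ x)⁻¹ =
      P i₀ k₀ * (Q.totient : ℂ) := by
    simp_rw [Finset.sum_mul]
    rw [Finset.sum_comm]
    simp_rw [mul_assoc, ← Finset.mul_sum, sum_units_mul_inv, hinj.eq_iff]
    simp
  rw [hsum'] at hsum
  have hφ : (Q.totient : ℂ) ≠ 0 := by exact_mod_cast (Nat.totient_pos.2 (Nat.pos_of_ne_zero hQ0)).ne'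
  exact hi₀ ((mul_eq_zero.1 hsum).resolve_right hφ)

end SWTwist

end Literature.NumberTheory.LFunctions
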